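import Summits.CriticalPhenomena.PercolationContinuityZ3.Theorems.PercNearOneGluingNoHeavyLowerTailQuantitativeS5Rigidity
import HarnessLib

/-!
# The (S5) zero set of a REAL-valued monotone functional is decided by its LEVEL EVENTS

Support file (`--supports stmt-CriticalPhenomena-4575`), prover seat `prim-rate-mine-2` (lane prim-rate, constants-miner (c), BENCH row
M2-R31; `run/shared/lean/prim/prim-rate/prim-rate-mine-2/PROOFS.md` §P30).  No definitions, no named facts, no sorries; standard axioms.

The decoy-free (S5) margin is LINEAR in the functional (`CSH.s5dMargin_nil_add_smul`) and kills constants (`CSH.s5dMargin_nil_const`, the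
first-in-rank patterns partition `{u ↔ T}` for an injective rank).  Peeling the top value of a functional on the finite type `Set (Fin n)`
(layer cake, by induction on the number of values):

* `CSH.s5dMargin_nil_eq_zero_of_forall_levelSet` — if EVERY level event `1{t ≤ F(·)}` has zero margin at the rank `r`, then `F` has zero margin
  at `r` (any `F`, any weights; `r` injective on `T`);
* `CSH.s5dMargin_nil_eq_zero_iff_forall_levelSet_of_strictCompat` — with the rigidity theorem (`CSH.s5dMargin_nil_levelSet_eq_zero`, row M2-R31):
  for a monotone `F` at a STRICTLY `m(F)`-compatible injective rank (and `μ(v ↮ T) > 0`),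
  **`s5dMargin w T r [] o v F = 0 ↔ ∀ t, s5dMargin w T r [] o v 1{t ≤ F(·)} = 0`** — the equality locus of (S5) for real-valued monotone
  functionals is the intersection of the loci of its (increasing) level EVENTS, read at the same rank.
[cite: KozmaNitzan2024, Conj. 4 (p. 32)]
-/

noncomputable section

namespace Summit.CriticalPhenomena.PercolationContinuityZ3.Theorems

open MeasureTheory Set Literature.Probability.LatticeModels Literature.Probability.Percolation
open scoped Classical

namespace CSH

variable {n : ℕ}

/-- For an injective rank the first-in-rank patterns partition `{u ↔ T}`: `Σ_{a ∈ T} μ(P^u_a) = μ(u ↔ T)`. [cite: KozmaNitzan2024, Conj. 4 (p. 32)] -/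
theorem sum_real_pattern_eq (w : Sym2 (Fin n) → unitInterval) (T : Finset (Fin n)) (r : Fin n → ℕ) (hr : Set.InjOn r ↑T) (u : Fin n) :
    ∑ a ∈ T, (prodBernoulli w).real
        (openConn u a ∩ ⋂ a' ∈ T.filter (fun a' => r a' < r a), (openConn u a')ᶜ : Set (BondConfig (Fin n))) =
      (prodBernoulli w).real (⋃ a ∈ T, (openConn u a : Set (BondConfig (Fin n)))) := by
  set μ := prodBernoulli w with hμ
  have hmeas : ∀ S : Set (BondConfig (Fin n)), MeasurableSet S := fun _ => MeasurableSet.of_discrete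
  set P : Fin n → Set (BondConfig (Fin n)) := fun a =>
    (openConn u a ∩ ⋂ a' ∈ T.filter (fun a' => r a' < r a), (openConn u a')ᶜ : Set (BondConfig (Fin n))) with hP
  -- pairwise disjoint
  have hdisj : Set.PairwiseDisjoint (↑T : Set (Fin n)) P := by
    intro a ha b hb hab
    rw [Function.onFun, Set.disjoint_left]
    intro ω hωa hωb
    simp only [hP, mem_inter_iff, mem_iInter, mem_compl_iff, Finset.mem_filter] at hωa hωb
    rcases lt_trichotomy (r a) (r b) with h | h | h
    · exact hωb.2 a ⟨Finset.mem_coe.1 ha, h⟩ hωa.1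
    · exact hab (hr ha hb h)
    · exact hωa.2 b ⟨Finset.mem_coe.1 hb, h⟩ hωb.1
  -- the union is `{u ↔ T}`: the first-ranked relay of the cluster of `u`
  have hunion : (⋃ a ∈ T, P a) = ⋃ a ∈ T, (openConn u a : Set (BondConfig (Fin n))) := by
    ext ω
    simp only [mem_iUnion, exists_prop]
    constructor
    · rintro ⟨a, ha, hω⟩
      exact ⟨a, ha, hω.1⟩
    · rintro ⟨a, ha, hω⟩
      -- the `r`-minimal relay connected to `u`
      obtain ⟨b, hb, hbmin⟩ := Finset.exists_min_image (T.filter fun c => ω ∈ (openConn u c : Set (BondConfig (Fin n)))) r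
        ⟨a, Finset.mem_filter.2 ⟨ha, hω⟩⟩
      refine ⟨b, (Finset.mem_filter.1 hb).1, (Finset.mem_filter.1 hb).2, ?_⟩
      simp only [mem_iInter, mem_compl_iff, Finset.mem_filter]
      intro c hc hωc
      exact absurd (hbmin c (Finset.mem_filter.2 ⟨hc.1, hωc⟩)) (not_le.2 hc.2)
  rw [← hunion, measureReal_biUnion_finset hdisj (fun a _ => hmeas _)]

/-- The (S5) margin of a CONSTANT functional vanishes (injective rank). [cite: KozmaNitzan2024, Conj. 4 (p. 32)] -/
theorem s5dMargin_nil_const (w : Sym2 (Fin n) → unitInterval) (T : Finset (Fin n)) (r : Fin n → ℕ) (hr : Set.InjOn r ↑T)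
    (o v : Fin n) (c : ℝ) : s5dMargin w T r [] o v (fun _ : Set (Fin n) => c) = 0 := by
  have hc' : ∫ ω, (c : ℝ) ∂(prodBernoulli w) = c := by
    simp only [integral_const, smul_eq_mul, probReal_univ, one_mul]
  have hsur : ∀ u : Fin n, surplus w T r (fun _ : Set (Fin n) => c) u = 0 := by
    intro u
    unfold surplus
    rw [setIntegral_const]
    simp only [hc', smul_eq_mul]
    rw [← Finset.sum_mul, sum_real_pattern_eq w T r hr u]
    ring
  rw [s5dMargin_nil, hsur, hsur, mul_zero, sub_zero]

/-- **All level events are zeros ⟹ the functional is a zero** (layer cake; any `F` on the finite type, any weights, injective rank).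
[cite: KozmaNitzan2024, Conj. 4 (p. 32)] -/
theorem s5dMargin_nil_eq_zero_of_forall_levelSet (w : Sym2 (Fin n) → unitInterval) (T : Finset (Fin n)) (r : Fin n → ℕ)
    (hr : Set.InjOn r ↑T) (o v : Fin n) (F : Set (Fin n) → ℝ)
    (h : ∀ t : ℝ, s5dMargin w T r [] o v (fun S : Set (Fin n) => if t ≤ F S then (1 : ℝ) else 0) = 0) :
    s5dMargin w T r [] o v F = 0 := by
  -- induction on the number of values of `F`
  suffices main : ∀ (k : ℕ) (F : Set (Fin n) → ℝ), (Finset.univ.image F).card ≤ k →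
      (∀ t : ℝ, s5dMargin w T r [] o v (fun S : Set (Fin n) => if t ≤ F S then (1 : ℝ) else 0) = 0) →
      s5dMargin w T r [] o v F = 0 from main _ F le_rfl h
  intro k
  induction k with
  | zero =>
    intro F hk _
    have : (Finset.univ.image F).Nonempty := Finset.image_nonempty.2 ⟨∅, Finset.mem_univ _⟩
    exact absurd hk (not_le.2 (Finset.card_pos.2 this))
  | succ k ih =>
    intro F hk hF
    set vals := Finset.univ.image F with hvals
    have hne : vals.Nonempty := Finset.image_nonempty.2 ⟨∅, Finset.mem_univ _⟩
    set tmax := vals.max' hne with htmax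
    have hle : ∀ S, F S ≤ tmax := fun S => Finset.le_max' vals (F S) (Finset.mem_image_of_mem F (Finset.mem_univ S))
    by_cases hconst : ∀ S, F S = tmax
    · -- constant functional
      have : F = fun _ => tmax := funext hconst
      rw [this]
      exact s5dMargin_nil_const w T r hr o v tmax
    · -- peel the top value: `F = min(F, t₂) + (tmax − t₂) • 1{tmax ≤ F}` with `t₂` the second largest value
      push Not at hconst
      set vals' := vals.erase tmax with hvals'
      have hne' : vals'.Nonempty := by
        obtain ⟨S, hS⟩ := hconst
        exact ⟨F S, Finset.mem_erase.2 ⟨hS, Finset.mem_image_of_mem F (Finset.mem_univ S)⟩⟩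
      set t₂ := vals'.max' hne' with ht₂
      have ht₂lt : t₂ < tmax := by
        have hmem : t₂ ∈ vals' := Finset.max'_mem vals' hne'
        exact lt_of_le_of_ne (Finset.le_max' vals t₂ (Finset.mem_of_mem_erase hmem)) (Finset.ne_of_mem_erase hmem)
      have hlow : ∀ S, F S ≠ tmax → F S ≤ t₂ := fun S hS =>
        Finset.le_max' vals' (F S) (Finset.mem_erase.2 ⟨hS, Finset.mem_image_of_mem F (Finset.mem_univ S)⟩)
      set F' : Set (Fin n) → ℝ := fun S => min (F S) t₂ with hF'
      have hdecomp : F = F' + (tmax - t₂) • (fun S : Set (Fin n) => if tmax ≤ F S then (1 : ℝ) else 0) := by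
        funext S
        simp only [hF', Pi.add_apply, Pi.smul_apply, smul_eq_mul]
        by_cases hS : F S = tmax
        · rw [if_pos hS.symm.le, hS, min_eq_right ht₂lt.le]; ring
        · rw [if_neg (fun h' => hS (le_antisymm (hle S) h')), min_eq_left (hlow S hS)]; ring
      -- `F'` has fewer values
      have hcard : (Finset.univ.image F').card ≤ k := by
        have hsub : Finset.univ.image F' ⊆ vals' := by
          intro t ht
          obtain ⟨S, _, rfl⟩ := Finset.mem_image.1 ht
          by_cases hS : F S = tmax
          · simp only [hF', hS, min_eq_right ht₂lt.le]
            exact Finset.max'_mem vals' hne'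
          · simp only [hF', min_eq_left (hlow S hS)]
            exact Finset.mem_erase.2 ⟨hS, Finset.mem_image_of_mem F (Finset.mem_univ S)⟩
        have h1 := Finset.card_le_card hsub
        have h2 : vals'.card = vals.card - 1 := Finset.card_erase_of_mem (Finset.max'_mem vals hne)
        omega
      -- the level events of `F'` are level events of `F` (or empty)
      have hlev : ∀ t : ℝ, s5dMargin w T r [] o v (fun S : Set (Fin n) => if t ≤ F' S then (1 : ℝ) else 0) = 0 := by
        intro t
        by_cases ht : t ≤ t₂
        · have : (fun S : Set (Fin n) => if t ≤ F' S then (1 : ℝ) else 0) = fun S => if t ≤ F S then (1 : ℝ) else 0 := by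
            funext S
            simp only [hF', le_min_iff, ht, and_true]
          rw [this]; exact hF t
        · have : (fun S : Set (Fin n) => if t ≤ F' S then (1 : ℝ) else 0) = fun _ => 0 := by
            funext S
            rw [if_neg (fun h' => ht (h'.trans (min_le_right _ _)))]
          rw [this]; exact s5dMargin_nil_const w T r hr o v 0
      have hF'0 := ih F' hcard hlev
      rw [hdecomp, s5dMargin_nil_add_smul, hF'0, hF tmax, mul_zero, add_zero]

/-- **The zero set of a real monotone functional = the intersection of the zero sets of its level events** (strictly compatible rank).
Any weights with `μ(v ↮ T) > 0`; `v ∉ T`; `F` monotone; `r` injective and strictly `m(F)`-compatible.  (⟹ rigidity, row M2-R31; ⟸ layer cake.)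
[cite: KozmaNitzan2024, Conj. 4 (p. 32)] -/
theorem s5dMargin_nil_eq_zero_iff_forall_levelSet_of_strictCompat (w : Sym2 (Fin n) → unitInterval) (T : Finset (Fin n)) (o v : Fin n)
    (F : Set (Fin n) → ℝ) (r : Fin n → ℕ) (hvT : v ∉ T)
    (hF : ∀ S S' : Set (Fin n), S ⊆ S' → F S ≤ F S') (hr : Set.InjOn r ↑T)
    (hstrict : ∀ a ∈ T, ∀ a' ∈ T, r a < r a' →
      ∫ ω, F (openCluster ω a) ∂(prodBernoulli w) < ∫ ω, F (openCluster ω a') ∂(prodBernoulli w))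
    (hpos : 0 < (prodBernoulli w).real {ω : BondConfig (Fin n) | ∀ a ∈ T, ¬ (openGraph ω).Reachable v a}) :
    s5dMargin w T r [] o v F = 0 ↔ ∀ t : ℝ, s5dMargin w T r [] o v (fun S : Set (Fin n) => if t ≤ F S then (1 : ℝ) else 0) = 0 :=
  ⟨fun h0 t => s5dMargin_nil_levelSet_eq_zero w T o v F r t hvT hF hr hstrict hpos h0,
    fun h => s5dMargin_nil_eq_zero_of_forall_levelSet w T r hr o v F h⟩

end CSH

end Summit.CriticalPhenomena.PercolationContinuityZ3.Theorems

end
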